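import Literature.AlgebraicGeometry.Motives.HodgeThetaSubalgebraUnitaryCoprimeCore
import HarnessLib

/-!
# TOOL H: the raising operators of an irreducible `Θ`-algebra with `dim P, dim Q ≥ 2` do not all have rank `≤ 1`
# (Ribet 1983 Thm. 3, Lie step — the square Levi pieces of the minimal-rank method)

Family `hodge`, layer `Literature/AlgebraicGeometry/Motives` (pure linear algebra over `ℂ`; no geometry). Research
context: cell `pub-hodge-ring2` (HONEST FRAMING: research route conditional on HC_CM; not a corollary; Q11.4-sentence-2
already refuted in dim ≥ 3), Literature lane gen 89. UNCONDITIONAL; theorems only, no definition, no named fact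
(D-0026), no `sorry`.

THE PRINT. K. A. Ribet, Amer. J. Math. 105 (1983), Thm. 3 = Gordon's survey Thm. 6.3 (3) [held
`paper:arxiv-alg-geom_9709030` p. 18]: `End⁰ = k` imaginary quadratic with coprime multiplicities ⟹ `Hg = U(V, φ)`. The
lane replaces the classification of minuscule representations (Serre) by the minimal-rank method
(`HodgeThetaSubalgebraUnitarySixteenTwentyOneCore` ff.), whose sub-Levi recursion meets SQUARE Levi pieces of type
`(k | k)`; there `UnitaryRankOneRaise.eq_top_of_rankOne_raise` (which needs `dim P ≠ dim Q`) is not available — indeed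
`𝔰𝔭₂ₖ ⊂ 𝔤𝔩₂ₖ` has rank-one raising elements. What survives, classification-free, is:

**`UnitarySquareRankOne.false_of_raise_rank_le_one`** — if `𝔊 ⊆ End(W)` is bracket-closed and irreducible, `Θ ∈ 𝔊` an
involution with eigenspaces `P` (`+1`), `Q` (`−1`) both of dimension `≥ 2`, then the raising operators of `𝔊`
(`ΘX = X = −XΘ`) cannot ALL have rank `≤ 1` once one of them is non-zero. PROOF (no Hermitian data needed). Fix a raising
`B ≠ 0`, so `rk B = 1`. (i) PAIR LEMMA: a raising `X` has `X(W) ⊆ B(W)` or kills `Q ∩ ker B` — otherwise pick `h ∈ Q ∩ ker B`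
with `Xh ≠ 0` and `w` with `Bw ≠ 0`; `rk (B + X) ≤ 1` and `(B + X)h = Xh` put `Bw + Xw` on the line `ℂ·Xh`, and `rk X ≤ 1`
puts `Xw` there too, so `0 ≠ Bw ∈ ℂ·Xh`, i.e. `X(W) = ℂ·Xh = ℂ·Bw = B(W)`. (ii) The two alternatives are closed under
differences, so (a vector space is not the union of two proper subspaces) EITHER every raising `X` has `X(W) ⊆ B(W)`, OR
every raising `X` kills `Q ∩ ker B`. (iii) In the first case the covering fact
`UnitaryThetaCore.mem_span_raise_apply` (the values of the raising operators span `P`) gives `P ⊆ B(W)`, `dim P ≤ 1`; in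
the second, `Q ∩ ker B ≠ 0` (as `rk B ≤ 1 < dim Q`) contradicts the covering fact
`UnitaryThetaCore.eq_zero_of_forall_raise_apply_eq_zero` (no non-zero vector of `Q` is killed by all raising operators).
USE (lit-g89 planner, TOOL H): a constant profile `(1, j)` / `(i, 1)` at a base point whose Levi piece `L⁺` / `L⁻` is
square of type `(k | k)`, `k ≥ 2`, is impossible — this closes the cells `(35, 38)` (`p = 73`) and `(38, 45)` (`p = 83`).

## References
* [Ribet1983] K. A. Ribet, *Hodge classes on certain types of abelian varieties*, Amer. J. Math. 105 (1983), Thm. 3.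
* [Gordon1997] B. B. Gordon, *A survey of the Hodge conjecture for abelian varieties*, Thm. 6.3 (3), pp. 18–19.
* [GoodmanWallachGTM255] R. Goodman, N. R. Wallach, GTM 255 (2009), §4.1.1 (gradings by an involution).
* [HoffmanKunze1971LinearAlgebra] K. Hoffman, R. Kunze, *Linear Algebra* (1971), §3.1 Thm. 2 (rank–nullity), §2.3.
-/

noncomputable section

open Module

namespace Literature.AlgebraicGeometry.Motives

namespace HodgeStructure

universe u

variable {W : Type u} [AddCommGroup W] [Module ℂ W]

/-- **TOOL H.** In an irreducible bracket-closed `𝔊 ∋ Θ` (`Θ² = 1`, eigenspaces `P`, `Q` of dimension `≥ 2`) the raising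
operators cannot all have rank `≤ 1` when one of them is non-zero (pair lemma + «a vector space is not a union of two
proper subspaces» + the two covering facts of `HodgeThetaSubalgebraUnitaryCoprimeCore` §3).
[cite: Ribet1983, Thm. 3] [cite: Gordon1997, Thm. 6.3 (3)] [cite: GoodmanWallachGTM255, §4.1.1]
[cite: HoffmanKunze1971LinearAlgebra, §3.1 Thm. 2] -/
theorem UnitarySquareRankOne.false_of_raise_rank_le_one [FiniteDimensional ℂ W] {𝔊 : Submodule ℂ (Module.End ℂ W)}
    (hbr : ∀ Y ∈ 𝔊, ∀ Z ∈ 𝔊, Y * Z - Z * Y ∈ 𝔊)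
    (hirr : ∀ U : Submodule ℂ W, (∀ A ∈ 𝔊, ∀ u ∈ U, A u ∈ U) → U = ⊥ ∨ U = ⊤)
    {Θ : Module.End ℂ W} (hΘ : Θ ∈ 𝔊) (hΘΘ : Θ * Θ = 1)
    {P Q : Submodule ℂ W} (hP : ∀ x, x ∈ P ↔ Θ x = x) (hQ : ∀ x, x ∈ Q ↔ Θ x = -x)
    (h2P : 2 ≤ Module.finrank ℂ P) (h2Q : 2 ≤ Module.finrank ℂ Q)
    (hle : ∀ X ∈ 𝔊, Θ * X = X → X * Θ = -X → Module.finrank ℂ (LinearMap.range X) ≤ 1)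
    {B : Module.End ℂ W} (hB : B ∈ 𝔊) (hΘB : Θ * B = B) (hBΘ : B * Θ = -B)
    (hr : 0 < Module.finrank ℂ (LinearMap.range B)) : False := by
  classical
  -- a vector `w` with `B w ≠ 0`
  obtain ⟨⟨y, hy⟩, hy0⟩ := Module.finrank_pos_iff_exists_ne_zero.1 hr
  have hy0' : y ≠ 0 := fun h => hy0 (Subtype.ext h)
  obtain ⟨w, hw⟩ := LinearMap.mem_range.1 hy
  have hBw : B w ≠ 0 := by rw [hw]; exact hy0'
  -- lines: a submodule of dimension `≤ 1` containing `v ≠ 0` is `ℂ ∙ v`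
  have hline : ∀ (T : Submodule ℂ W) (v : W), v ∈ T → v ≠ 0 → Module.finrank ℂ T ≤ 1 → T = ℂ ∙ v := by
    intro T v hv hv0 hT
    refine (Submodule.eq_of_le_of_finrank_le ((Submodule.span_singleton_le_iff_mem v T).2 hv) ?_).symm
    rw [finrank_span_singleton hv0]; exact hT
  -- (i) the pair lemma
  have hpair : ∀ X ∈ 𝔊, Θ * X = X → X * Θ = -X →
      LinearMap.range X ≤ LinearMap.range B ∨ ∀ h ∈ Q, B h = 0 → X h = 0 := by
    intro X hX hΘX hXΘ
    by_contra hnot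
    rw [not_or] at hnot
    obtain ⟨him, hker⟩ := hnot
    push Not at hker
    obtain ⟨h, hhQ, hBh, hXh⟩ := hker
    -- `X(W) = ℂ ∙ Xh`
    have hrX : LinearMap.range X = ℂ ∙ X h :=
      hline _ _ (LinearMap.mem_range_self X h) hXh (hle X hX hΘX hXΘ)
    -- `(B + X)(W) = ℂ ∙ Xh`
    have hBX : B + X ∈ 𝔊 := Submodule.add_mem _ hB hX
    have hΘBX : Θ * (B + X) = B + X := by rw [mul_add, hΘB, hΘX]
    have hBXΘ : (B + X) * Θ = -(B + X) := by rw [add_mul, hBΘ, hXΘ, neg_add]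
    have hBXh : (B + X) h = X h := by rw [LinearMap.add_apply, hBh, zero_add]
    have hrBX : LinearMap.range (B + X) = ℂ ∙ X h :=
      hline _ _ (by rw [← hBXh]; exact LinearMap.mem_range_self _ h) hXh (hle _ hBX hΘBX hBXΘ)
    -- `Bw + Xw` and `Xw` lie on the line, hence so does `Bw ≠ 0`
    obtain ⟨d, hd⟩ := Submodule.mem_span_singleton.1 (hrBX ▸ LinearMap.mem_range_self (B + X) w)
    obtain ⟨c, hc⟩ := Submodule.mem_span_singleton.1 (hrX ▸ LinearMap.mem_range_self X w)
    have hBw' : B w = (d - c) • X h := by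
      rw [sub_smul, hd, hc, LinearMap.add_apply, add_sub_cancel_right]
    have hdc : d - c ≠ 0 := fun h0 => hBw (by rw [hBw', h0, zero_smul])
    have hXhmem : X h ∈ LinearMap.range B := by
      have : X h = (d - c)⁻¹ • B w := by rw [hBw', smul_smul, inv_mul_cancel₀ hdc, one_smul]
      rw [this]; exact Submodule.smul_mem _ _ (LinearMap.mem_range_self B w)
    exact him (by rw [hrX]; exact (Submodule.span_singleton_le_iff_mem _ _).2 hXhmem)
  -- (ii) one of the two alternatives holds for ALL raising operators
  have hdich : (∀ X ∈ 𝔊, Θ * X = X → X * Θ = -X → LinearMap.range X ≤ LinearMap.range B) ∨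
      (∀ X ∈ 𝔊, Θ * X = X → X * Θ = -X → ∀ h ∈ Q, B h = 0 → X h = 0) := by
    by_cases hall : ∀ X ∈ 𝔊, Θ * X = X → X * Θ = -X → LinearMap.range X ≤ LinearMap.range B
    · exact Or.inl hall
    · right
      push Not at hall
      obtain ⟨X₁, hX₁, hΘX₁, hX₁Θ, hX₁im⟩ := hall
      have hX₁ker : ∀ h ∈ Q, B h = 0 → X₁ h = 0 := (hpair X₁ hX₁ hΘX₁ hX₁Θ).resolve_left hX₁im
      intro X₂ hX₂ hΘX₂ hX₂Θ
      by_contra hX₂ker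
      have hX₂im : LinearMap.range X₂ ≤ LinearMap.range B := (hpair X₂ hX₂ hΘX₂ hX₂Θ).resolve_right hX₂ker
      have h12 : X₁ + X₂ ∈ 𝔊 := Submodule.add_mem _ hX₁ hX₂
      have hΘ12 : Θ * (X₁ + X₂) = X₁ + X₂ := by rw [mul_add, hΘX₁, hΘX₂]
      have h12Θ : (X₁ + X₂) * Θ = -(X₁ + X₂) := by rw [add_mul, hX₁Θ, hX₂Θ, neg_add]
      rcases hpair _ h12 hΘ12 h12Θ with him | hker
      · apply hX₁im
        rintro _ ⟨v, rfl⟩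
        have hv : X₁ v = (X₁ + X₂) v - X₂ v := by rw [LinearMap.add_apply, add_sub_cancel_right]
        rw [hv]
        exact Submodule.sub_mem _ (him (LinearMap.mem_range_self _ v)) (hX₂im (LinearMap.mem_range_self _ v))
      · apply hX₂ker
        intro h hhQ hBh
        have hv : X₂ h = (X₁ + X₂) h - X₁ h := by rw [LinearMap.add_apply, add_sub_cancel_left]
        rw [hv, hker h hhQ hBh, hX₁ker h hhQ hBh, sub_zero]
  -- non-zero vectors of `P` and of `Q`
  have hP0 : ∃ p : W, p ≠ 0 ∧ Θ p = p := by
    obtain ⟨⟨p, hp⟩, hp0⟩ := Module.finrank_pos_iff_exists_ne_zero.1 (lt_of_lt_of_le Nat.zero_lt_two h2P)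
    exact ⟨p, fun h => hp0 (Subtype.ext h), (hP p).1 hp⟩
  have hQ0 : ∃ q : W, q ≠ 0 ∧ Θ q = -q := by
    obtain ⟨⟨q, hq⟩, hq0⟩ := Module.finrank_pos_iff_exists_ne_zero.1 (lt_of_lt_of_le Nat.zero_lt_two h2Q)
    exact ⟨q, fun h => hq0 (Subtype.ext h), (hQ q).1 hq⟩
  rcases hdich with him | hker
  · -- (iii a) the values of the raising operators span `P`, so `P ⊆ B(W)` has dimension `≤ 1`
    have hPle : P ≤ LinearMap.range B := by
      intro p hp
      have hspan := UnitaryThetaCore.mem_span_raise_apply hbr hirr hΘ hΘΘ hQ0 ((hP p).1 hp)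
      refine (Submodule.span_le.2 ?_) hspan
      rintro x ⟨B', hB', hΘB', hB'Θ, v, rfl⟩
      exact him B' hB' hΘB' hB'Θ (LinearMap.mem_range_self B' v)
    have := (Submodule.finrank_mono hPle).trans (hle B hB hΘB hBΘ)
    omega
  · -- (iii b) `Q ∩ ker B ≠ 0` is killed by every raising operator
    have hnotinj : ¬ Function.Injective (B.domRestrict Q) := by
      intro hinj
      have h1 : Module.finrank ℂ Q = Module.finrank ℂ (LinearMap.range (B.domRestrict Q)) :=
        (LinearMap.finrank_range_of_inj hinj).symm
      have h2 : LinearMap.range (B.domRestrict Q) ≤ LinearMap.range B := by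
        rintro _ ⟨q, rfl⟩; exact LinearMap.mem_range_self B (q : W)
      have := (Submodule.finrank_mono h2).trans (hle B hB hΘB hBΘ)
      omega
    obtain ⟨⟨h, hhQ⟩, hh, hh0⟩ : ∃ q : Q, B.domRestrict Q q = 0 ∧ q ≠ 0 := by
      by_contra hno
      push Not at hno
      exact hnotinj ((injective_iff_map_eq_zero _).2 fun q hq => hno q hq)
    rw [LinearMap.domRestrict_apply] at hh
    have hh0' : h ≠ 0 := fun h0 => hh0 (Subtype.ext h0)
    exact hh0' (UnitaryThetaCore.eq_zero_of_forall_raise_apply_eq_zero hbr hirr hΘ hΘΘ hP0 ((hQ h).1 hhQ)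
      fun X hX hΘX hXΘ => hker X hX hΘX hXΘ h hhQ hh)

end HodgeStructure

end Literature.AlgebraicGeometry.Motives

end
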